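import Summits.Ventures.DiscreteObjects.PP12.OrbitCountPrimeOrder
import Summits.Ventures.DiscreteObjects.PP12.FanoExteriorLines
import Summits.Ventures.DiscreteObjects.PP12.FlagTenIndexSets

/-!
# Index sets of the order-5 orbit matrix: tangent orbits `(x, a)` and exterior orbits `e` (kernel; Step A of the FanoFiveReduction)
Framing: lottery ticket; floor = certified bounds/negative ranges.

Cell pub-namedobj (venture DiscreteObjects), target (M), designs gen 15. Setting: projective plane of order 12, collineation `σ ≠ 1` with `σ⁵ = 1`
(fixed Fano subplane, `OrderFive.fano_of_pow_five`; tangent/exterior counts `FanoExterior`, `FanoExteriorLines`, designs g10). This file identifies the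
index type `F5Idx = (Fin 7 × Fin 2) ⊕ Fin 16` of `IsFanoFiveOrbitMatrix` (designs g15) with the non-trivial orbits:
* `card_image_orbP` — a `τ`-stable set of non-fixed points splits into orbits of length `p` (`p` prime): `p · #orbits = #set`;
* `card_tlines_five` / `card_tlineOrbits_five` — through a fixed point `x` pass exactly `10` non-fixed lines, in `2` orbits; dually `card_tpoints_five` /
  `card_tpointOrbits_five` on a fixed line;
* `card_extPointOrbits_five` / `card_extLineOrbits_five` — the `80` exterior points / lines form `16` orbits each;
* the `Fin` equivalences `e7P`, `e7L`, `eTL`, `eTP`, `eEP`, `eEL`.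
No `sorry`, no new axioms.
-/

namespace Summit.Ventures.DiscreteObjects.PP12

open Configuration Finset
open scoped Classical

section Perm

variable {α : Type*} [DecidableEq α]

omit [DecidableEq α] in
/-- Points of the orbit of `x ∈ S` stay in a `τ`-stable `S`. -/
theorem orbP_subset_of_stable (τ : Equiv.Perm α) (p : ℕ) (S : Finset α) (hS : ∀ x ∈ S, τ x ∈ S) {x : α} (hx : x ∈ S) :
    orbP τ p x ⊆ S := by
  intro y hy
  obtain ⟨k, -, rfl⟩ := (mem_orbP τ p x y).1 hy
  clear hy
  induction k with
  | zero => simpa using hx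
  | succ k ih => rw [pow_succ', Equiv.Perm.mul_apply]; exact hS _ ih

/-- **Orbits partition a stable set into `p`-sets** (`τ ^ p = 1`, `p` prime): if every point of `S` is moved by `τ` and `τ S ⊆ S`, then
`p · #(S.image (orbP τ p)) = #S`. -/
theorem card_image_orbP (τ : Equiv.Perm α) {p : ℕ} (hprime : p.Prime) (h : τ ^ p = 1) (S : Finset α) (hS : ∀ x ∈ S, τ x ∈ S)
    (hnf : ∀ x ∈ S, τ x ≠ x) : p * (S.image (orbP τ p)).card = S.card := by
  have hp : 0 < p := hprime.pos
  have hunion : (S.image (orbP τ p)).biUnion id = S := by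
    ext y
    simp only [mem_biUnion, mem_image, id]
    constructor
    · rintro ⟨O, ⟨x, hx, rfl⟩, hy⟩; exact orbP_subset_of_stable τ p S hS hx hy
    · intro hy; exact ⟨orbP τ p y, ⟨y, hy, rfl⟩, self_mem_orbP _ hp _⟩
  have hdisj : ∀ O ∈ S.image (orbP τ p), ∀ O' ∈ S.image (orbP τ p), O ≠ O' → Disjoint (id O) (id O') := by
    intro O hO O' hO' hne
    obtain ⟨x, -, rfl⟩ := mem_image.1 hO
    obtain ⟨x', -, rfl⟩ := mem_image.1 hO'
    rw [Finset.disjoint_left]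
    intro y hy hy'
    exact hne ((orbP_eq_of_mem τ h hp hy).symm.trans (orbP_eq_of_mem τ h hp hy'))
  have hcard := Finset.card_biUnion hdisj
  rw [hunion] at hcard
  rw [hcard, Finset.sum_const_nat (m := p) fun O hO => ?_]
  · ring
  · obtain ⟨x, hx, rfl⟩ := mem_image.1 hO
    exact card_orbP_of_ne τ hprime h (hnf x hx)

end Perm

namespace Collineation

variable {P L : Type*} [Membership P L] [ProjectivePlane P L] [Fintype P] [Fintype L] (σ : Collineation P L)

/-- fixed points -/
abbrev FixP5 : Type _ := {x : P // σ.onPoints x = x}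
/-- fixed lines -/
abbrev FixL5 : Type _ := {m : L // σ.onLines m = m}
/-- tangent-line orbits through the point `x` -/
abbrev TLOrb5 (x : P) : Type _ := ((univ.filter fun m : L => x ∈ m ∧ σ.onLines m ≠ m).image (orbP σ.onLines 5) : Finset (Finset L))
/-- tangent-point orbits on the line `μ` -/
abbrev TPOrb5 (μ : L) : Type _ := ((univ.filter fun y : P => y ∈ μ ∧ σ.onPoints y ≠ y).image (orbP σ.onPoints 5) : Finset (Finset P))
/-- exterior point orbits -/
abbrev EPOrb5 : Type _ :=
  ((univ.filter fun y : P => σ.onPoints y ≠ y ∧ ∀ l : L, σ.onLines l = l → y ∉ l).image (orbP σ.onPoints 5) : Finset (Finset P))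
/-- exterior line orbits -/
abbrev ELOrb5 : Type _ :=
  ((univ.filter fun m : L => σ.onLines m ≠ m ∧ ∀ x : P, σ.onPoints x = x → x ∉ m).image (orbP σ.onLines 5) : Finset (Finset L))

section Five

variable (h12 : ProjectivePlane.order P L = 12) (hne : σ.onPoints ≠ 1) (hq : σ.onPoints ^ 5 = 1)

include h12 hne hq in
/-- `Fin 7 ≃` fixed points. -/
theorem card_fixP5 : Fintype.card σ.FixP5 = 7 := by
  rw [Fintype.card_subtype]; exact (σ.fano_of_pow_five h12 hne hq).1

include h12 hne hq in
/-- `Fin 7 ≃` fixed lines. -/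
theorem card_fixL5 : Fintype.card σ.FixL5 = 7 := by
  rw [Fintype.card_subtype]; exact (σ.fano_of_pow_five h12 hne hq).2.1

include h12 hne hq in
/-- **Through a fixed point pass exactly `10` non-fixed (tangent) lines** (`13 − 3`). -/
theorem card_tlines_five {x : P} (hx : σ.onPoints x = x) : (univ.filter fun m : L => x ∈ m ∧ σ.onLines m ≠ m).card = 10 := by
  have ht3 := (σ.fano_of_pow_five h12 hne hq).2.2.2 x hx
  have hall : (univ.filter fun m : L => x ∈ m).card = 13 := by rw [card_lines_through, h12]
  have hsplit := Finset.card_filter_add_card_filter_not (s := univ.filter fun m : L => x ∈ m) (fun m => σ.onLines m = m)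
  rw [Finset.filter_filter, Finset.filter_filter, hall] at hsplit
  have hfix : (univ.filter fun m : L => x ∈ m ∧ σ.onLines m = m).card = 3 := by
    unfold fixedThrough at ht3; convert ht3 using 2
  rw [hfix] at hsplit
  have : (univ.filter fun m : L => x ∈ m ∧ σ.onLines m ≠ m) = univ.filter fun m : L => x ∈ m ∧ ¬ σ.onLines m = m := rfl
  rw [this]; omega

include h12 hne hq in
/-- **The tangent lines through a fixed point form `2` orbits.** -/
theorem card_tlineOrbits_five {x : P} (hx : σ.onPoints x = x) : Fintype.card (σ.TLOrb5 x) = 2 := by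
  rw [Fintype.card_coe]
  have hqL : σ.onLines ^ 5 = 1 := σ.onLines_pow_eq_one hq
  have hS : ∀ m ∈ (univ.filter fun m : L => x ∈ m ∧ σ.onLines m ≠ m), σ.onLines m ∈ (univ.filter fun m : L => x ∈ m ∧ σ.onLines m ≠ m) := by
    intro m hm; rw [mem_filter] at hm ⊢
    refine ⟨mem_univ _, ?_, fun e => hm.2.2 (σ.onLines.injective e)⟩
    have := σ.mem_map hm.2.1; rwa [hx] at this
  have hnf : ∀ m ∈ (univ.filter fun m : L => x ∈ m ∧ σ.onLines m ≠ m), σ.onLines m ≠ m := fun m hm => (mem_filter.1 hm).2.2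
  have h := card_image_orbP σ.onLines Nat.prime_five hqL _ hS hnf
  rw [σ.card_tlines_five h12 hne hq hx] at h
  omega

include h12 hne hq in
/-- **On a fixed line lie exactly `10` non-fixed (tangent) points** (dual). -/
theorem card_tpoints_five {μ : L} (hμ : σ.onLines μ = μ) : (univ.filter fun y : P => y ∈ μ ∧ σ.onPoints y ≠ y).card = 10 := by
  have h12' : ProjectivePlane.order (Dual L) (Dual P) = 12 := by rw [ProjectivePlane.Dual.order]; exact h12
  have hneL : σ.dual.onPoints ≠ 1 := fun h => hne (σ.onPoints_eq_one_of_onLines h)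
  have hqL : σ.dual.onPoints ^ 5 = 1 := σ.onLines_pow_eq_one hq
  exact σ.dual.card_tlines_five (x := (μ : Dual L)) h12' hneL hqL hμ

include h12 hne hq in
/-- **The tangent points of a fixed line form `2` orbits.** -/
theorem card_tpointOrbits_five {μ : L} (hμ : σ.onLines μ = μ) : Fintype.card (σ.TPOrb5 μ) = 2 := by
  rw [Fintype.card_coe]
  have hS : ∀ y ∈ (univ.filter fun y : P => y ∈ μ ∧ σ.onPoints y ≠ y), σ.onPoints y ∈ (univ.filter fun y : P => y ∈ μ ∧ σ.onPoints y ≠ y) := by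
    intro y hy; rw [mem_filter] at hy ⊢
    exact ⟨mem_univ _, (σ.mem_fixedLine_iff hμ y).2 hy.2.1, fun e => hy.2.2 (σ.onPoints.injective e)⟩
  have hnf : ∀ y ∈ (univ.filter fun y : P => y ∈ μ ∧ σ.onPoints y ≠ y), σ.onPoints y ≠ y := fun y hy => (mem_filter.1 hy).2.2
  have h := card_image_orbP σ.onPoints Nat.prime_five hq _ hS hnf
  rw [σ.card_tpoints_five h12 hne hq hμ] at h
  omega

omit [ProjectivePlane P L] [Fintype P] [Fintype L] in
/-- images of an exterior point are exterior -/
theorem exterior_map' {Q : P} (hQ : ∀ l : L, σ.onLines l = l → Q ∉ l) : ∀ l : L, σ.onLines l = l → σ.onPoints Q ∉ l := by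
  intro l hl hQl
  exact hQ l hl ((σ.mem_fixedLine_iff hl Q).1 hQl)

include h12 hne hq in
/-- **The exterior points form `16` orbits.** -/
theorem card_extPointOrbits_five : Fintype.card σ.EPOrb5 = 16 := by
  rw [Fintype.card_coe]
  have h80 := (σ.fano_exterior_structure h12 hne hq).2.1
  have hS : ∀ y ∈ (univ.filter fun y : P => σ.onPoints y ≠ y ∧ ∀ l : L, σ.onLines l = l → y ∉ l),
      σ.onPoints y ∈ (univ.filter fun y : P => σ.onPoints y ≠ y ∧ ∀ l : L, σ.onLines l = l → y ∉ l) := by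
    intro y hy; rw [mem_filter] at hy ⊢
    exact ⟨mem_univ _, fun e => hy.2.1 (σ.onPoints.injective e), σ.exterior_map' hy.2.2⟩
  have hnf : ∀ y ∈ (univ.filter fun y : P => σ.onPoints y ≠ y ∧ ∀ l : L, σ.onLines l = l → y ∉ l), σ.onPoints y ≠ y :=
    fun y hy => (mem_filter.1 hy).2.1
  have h := card_image_orbP σ.onPoints Nat.prime_five hq _ hS hnf
  rw [h80] at h
  omega

include h12 hne hq in
/-- **The exterior lines form `16` orbits** (dual). -/
theorem card_extLineOrbits_five : Fintype.card σ.ELOrb5 = 16 := by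
  rw [Fintype.card_coe]
  have h80 := (σ.card_tangent_exterior_lines_fano h12 hne hq).2
  have hqL : σ.onLines ^ 5 = 1 := σ.onLines_pow_eq_one hq
  have hS : ∀ m ∈ (univ.filter fun m : L => σ.onLines m ≠ m ∧ ∀ x : P, σ.onPoints x = x → x ∉ m),
      σ.onLines m ∈ (univ.filter fun m : L => σ.onLines m ≠ m ∧ ∀ x : P, σ.onPoints x = x → x ∉ m) := by
    intro m hm; rw [mem_filter] at hm ⊢
    refine ⟨mem_univ _, fun e => hm.2.1 (σ.onLines.injective e), fun x hx hxm => hm.2.2 x hx ?_⟩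
    have := (σ.mem_iff x m).1 (by rw [hx]; exact hxm); exact this
  have hnf : ∀ m ∈ (univ.filter fun m : L => σ.onLines m ≠ m ∧ ∀ x : P, σ.onPoints x = x → x ∉ m), σ.onLines m ≠ m :=
    fun m hm => (mem_filter.1 hm).2.1
  have h := card_image_orbP σ.onLines Nat.prime_five hqL _ hS hnf
  rw [h80] at h
  omega

/-! ### The `Fin` equivalences -/

/-- `Fin 7 ≃` fixed points. -/
noncomputable def e7P : Fin 7 ≃ σ.FixP5 := (Fintype.equivFinOfCardEq (σ.card_fixP5 h12 hne hq)).symm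
/-- `Fin 7 ≃` fixed lines. -/
noncomputable def e7L : Fin 7 ≃ σ.FixL5 := (Fintype.equivFinOfCardEq (σ.card_fixL5 h12 hne hq)).symm
/-- `Fin 2 ≃` tangent-line orbits through the fixed point `x`. -/
noncomputable def eTL (x : σ.FixP5) : Fin 2 ≃ σ.TLOrb5 x.1 := (Fintype.equivFinOfCardEq (σ.card_tlineOrbits_five h12 hne hq x.2)).symm
/-- `Fin 2 ≃` tangent-point orbits on the fixed line `μ`. -/
noncomputable def eTP (μ : σ.FixL5) : Fin 2 ≃ σ.TPOrb5 μ.1 := (Fintype.equivFinOfCardEq (σ.card_tpointOrbits_five h12 hne hq μ.2)).symm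
/-- `Fin 16 ≃` exterior point orbits. -/
noncomputable def eEP : Fin 16 ≃ σ.EPOrb5 := (Fintype.equivFinOfCardEq (σ.card_extPointOrbits_five h12 hne hq)).symm
/-- `Fin 16 ≃` exterior line orbits. -/
noncomputable def eEL : Fin 16 ≃ σ.ELOrb5 := (Fintype.equivFinOfCardEq (σ.card_extLineOrbits_five h12 hne hq)).symm

end Five

end Collineation

end Summit.Ventures.DiscreteObjects.PP12
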